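import Summits.RiemannHypothesis.RiemannHypothesis.Theorems.TiltedLandingLaw421R3TouchedGlueHChildAll

/-! # TopChild-v1 — the FIRST child of a touching atomic pair from the pinning at its top (lens-1 g8; (CA787) (M1) sequel, the half that IS link content)

ONE TREE import: #1226 `…R3TouchedGlueHChildAll` (lens-2's socket `ChildrenCarryAll`, `childSupport`, `pairUnion`, `Touches`, `AtomicPair`).
(K) bookkeeping, SUPPORT only, no law, 0 sorries.  What it types, and what it deliberately does not:
* `PinnedTopAt f k z` = the conclusion shape of lens-1's `RhW08.Lens1Pinning.TopPinning` at `(k, z)` spelled out (that module is not in this import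
  closure): a non-real zero of `f⁽ᵏ⁺¹⁾` nested under `z` (`NestedStep`, CLOSED disc) or an NL event in `z`'s closed Jensen interval.
* `noTaller_of_touches_atomicPair`: for a touching atomic pair `(v, z)` (lens-2's `Touches f k v z ∧ AtomicPair f k v z`, `0 < Im v`) the TALLER member
  `z` has no taller toucher — the `NoTallerToucher` clause of `TopPinning`, spelled out; so `TopPinning` (hence `TopLinkLawQ`, #1202) applies AT `z`.
* `exists_child_of_pinnedTopAt`: if `z` is pinned, the NL branch is excluded at `z`, the zero set of `f⁽ᵏ⁺¹⁾` is conjugation-closed and the non-real zeros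
  of `f⁽ᵏ⁾` are simple, then `Ū = pairUnion v z` contains a level-`k` child `u` (`u ∈ childSupport f k Ū`) nested under `z`.  This is ONE of the two
  children `ChildrenCarryAll` asks for.
* NOT here, and not link content: the SECOND child and the energy clause `touchEnergyQ (k+1) ≤ Im u₁² + Im u₂²` (genealogy of the level-`(k+1)` pair =
  tracker / perturbative pair-cover content, C1's K-2 chain); and the NL exclusion is a genuine hypothesis — on `(z²+1)((z−4/5)²+(17/50)²)e^{54z/25}`
  (crit-1 W-b, STATUS l.8629) the pair is touching and atomic and ALL critical points are real, so `childSupport = ∅` there: the geometric half of (M1)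
  is false without a frame clause excluding the NL branch.
Nothing here bears on the truth of RH; RH is not proved; 33346/33347 OPEN; checked ≠ landed ≠ proved. -/

namespace RhW08.Lens1TopChild

open Complex Set
open scoped ComplexConjugate
open RhW08.QuadW RhW08.TouchedDissipation RhW08.TouchedGlueHChild RhW08.TouchedGlueHChildAll
open RhIdea6.G17.W07C7

/-- The pinning disjunction at `(k, z)`: a non-real zero of `f⁽ᵏ⁺¹⁾` with `NestedStep z w`, or an NL event `x` with `|x − Re z| ≤ Im z`
(= the conclusion of lens-1's `TopPinning` at this zero). -/
def PinnedTopAt (f : ℂ → ℂ) (k : ℕ) (z : ℂ) : Prop :=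
  (∃ w : ℂ, iteratedDeriv (k + 1) f w = 0 ∧ w.im ≠ 0 ∧ NestedStep z w) ∨ (∃ x : ℝ, |x - z.re| ≤ z.im ∧ NLEventOf f k x)

/-- (K) the taller member of a touching atomic pair has no taller toucher (the `NoTallerToucher` clause, spelled out). -/
theorem noTaller_of_touches_atomicPair {f : ℂ → ℂ} {k : ℕ} {v z : ℂ} (hv : 0 < v.im) (ht : Touches f k v z) (ha : AtomicPair f k v z) :
    ∀ b : ℂ, iteratedDeriv k f b = 0 → z.im < b.im → z.im + b.im < |z.re - b.re| := by
  intro b hb hzb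
  have hvz : v.im < z.im := ht.2.1
  have hbpos : 0 < b.im := hv.trans (hvz.trans hzb)
  have hbv : b ≠ v := fun h => by rw [h] at hzb; exact lt_asymm hvz hzb
  have hbz : b ≠ z := fun h => by rw [h] at hzb; exact lt_irrefl _ hzb
  exact (ha b hb hbpos hbv hbz).2

/-- (K) `NestedStep` is conjugation-invariant in the child slot. -/
theorem nestedStep_conj {z w : ℂ} (h : NestedStep z w) : NestedStep z (conj w) := by
  unfold NestedStep at h ⊢
  rw [conj_re, conj_im]
  nlinarith [h]

/-- (K) a point nested under `z` (`0 ≤ Im z`) lies in `z`'s closed axis-centred Jensen disc, hence in `pairUnion v z`. -/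
theorem mem_pairUnion_of_nestedStep {v z w : ℂ} (hz : 0 ≤ z.im) (h : NestedStep z w) : w ∈ pairUnion v z := by
  right
  have hsq : ‖w - (z.re : ℂ)‖ ^ 2 ≤ z.im ^ 2 := by
    rw [Complex.sq_norm, Complex.normSq_apply, sub_re, sub_im, ofReal_re, ofReal_im, sub_zero]
    unfold NestedStep at h
    nlinarith [h]
  have := abs_le_of_sq_le_sq (by simpa using hsq) hz
  rwa [abs_of_nonneg (norm_nonneg _)] at this

/-- ★ (K) FIRST CHILD: a pinned top `z` (`0 < Im z`) with the NL branch excluded, conjugation-closed critical set and simple non-real zeros of `f⁽ᵏ⁾`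
has a level-`k` child in `Ū = pairUnion v z` nested under `z`. -/
theorem exists_child_of_pinnedTopAt {f : ℂ → ℂ} {k : ℕ} {v z : ℂ} (hz : 0 < z.im) (hpin : PinnedTopAt f k z)
    (hNL : ¬ ∃ x : ℝ, |x - z.re| ≤ z.im ∧ NLEventOf f k x)
    (hconj : ∀ w : ℂ, iteratedDeriv (k + 1) f w = 0 → iteratedDeriv (k + 1) f (conj w) = 0)
    (hsimple : ∀ u : ℂ, iteratedDeriv k f u = 0 → u.im ≠ 0 → iteratedDeriv (k + 1) f u ≠ 0) :
    ∃ u : ℂ, u ∈ childSupport f k (pairUnion v z) ∧ NestedStep z u := by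
  rcases hpin with ⟨w, hw0, hwim, hN⟩ | hnl
  · have key : ∀ u : ℂ, iteratedDeriv (k + 1) f u = 0 → 0 < u.im → NestedStep z u →
        u ∈ childSupport f k (pairUnion v z) ∧ NestedStep z u := by
      intro u hu hupos hNu
      refine ⟨⟨⟨hu, fun hku => hsimple u hku hupos.ne' hu, mem_pairUnion_of_nestedStep hz.le hNu⟩, hupos⟩, hNu⟩
    rcases lt_or_gt_of_ne hwim with hneg | hpos
    · exact ⟨conj w, key (conj w) (hconj w hw0) (by rw [conj_im]; linarith) (nestedStep_conj hN)⟩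
    · exact ⟨w, key w hw0 hpos hN⟩
  · exact absurd hnl hNL

/-- (K) packaged for lens-2's pair: a touching atomic pair whose top is pinned (NL branch excluded, critical set conjugation-closed, simple non-real
zeros) has its first child in `Ū`. -/
theorem exists_child_of_pair {f : ℂ → ℂ} {k : ℕ} {v z : ℂ} (hv : 0 < v.im) (ht : Touches f k v z) (hpin : PinnedTopAt f k z)
    (hNL : ¬ ∃ x : ℝ, |x - z.re| ≤ z.im ∧ NLEventOf f k x)
    (hconj : ∀ w : ℂ, iteratedDeriv (k + 1) f w = 0 → iteratedDeriv (k + 1) f (conj w) = 0)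
    (hsimple : ∀ u : ℂ, iteratedDeriv k f u = 0 → u.im ≠ 0 → iteratedDeriv (k + 1) f u ≠ 0) :
    ∃ u : ℂ, u ∈ childSupport f k (pairUnion v z) ∧ NestedStep z u :=
  exists_child_of_pinnedTopAt (hv.trans ht.2.1) hpin hNL hconj hsimple

end RhW08.Lens1TopChild
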